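import Summits.FinalStateConjecture.FinalStateConjecture.Theorems.BartnikGapSettlingGapExhaustionKerrCoordKillingSweepSmoothT
import Summits.FinalStateConjecture.FinalStateConjecture.Theorems.BartnikGapSettlingGapExhaustionKerrRadiusFarTube
import HarnessLib

/-!
# Crux `GapExhaustion` (stmt-FinalStateConjecture-10808), line `photon-shell-pseudoconvexity`:
# stub (F5) `farConditionalSweep` — the DYADIC far sweep: a uniform RELATIVE local extension step
# on every cylinder `{r = c}`, `c ≥ c₀`, extends a commuting coordinate Killing field from the
# collar `{c₀/2 < r < c₀}` to the whole far region `{r > c₀/2}`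

Route `BartnikGapSettling`; helper (`--supports stmt-FinalStateConjecture-10808`) of line lead
c12 (far chain F5, chart level). The far completion of the `T`-conditional sweep S6b‴: the
scale-free local step (V-6T-far `ikLocalStepTFar_of_constants`) extends Killing data from
`ball x (ρf c) ∩ {r < c}` to `ball x (ρf' c)` at every far cylinder point, with the SAME fractions
`ρf, ρf'` at every radius. Here that relative step (hypothesis `hstep`) is iterated over the dyadic
bands `[c₀2ⁿ, c₀2ⁿ⁺¹]` by the conditional level sweep `stub_kerrCoordKillingSweepSmoothT`
(radii `ρₙ = 2ρf c₀2ⁿ`, `ρ'ₙ = ρf' c₀2ⁿ`; the balls stay in the arena `{c₀2ⁿ/2 < r < 4c₀2ⁿ}` by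
the far tube comparison `stub_kerrRadiusFarTube`, `ρf ≤ 1/8`, `16M ≤ c₀`), the successive fields
are glued on the overlaps where the sweep says they agree, and the limit field is read off
pointwise. [folklore globalisation; cf. Alexakis–Ionescu–Klainerman, CMP 299 (2010), §6]
-/

noncomputable section

-- instance search through the nested operator types `E4 →L[ℝ] E4 →L[ℝ] E4 →L[ℝ] ℝ`
set_option maxSynthPendingDepth 3

-- D-0017: single-problem summit, `Summit.<S>.<S>.…` by design (cf. lakefile `weak.linter.dupNamespace`).
set_option linter.dupNamespace false

namespace Summit.FinalStateConjecture.FinalStateConjecture.Theorems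

open Set Metric
open Literature.Geometry.Lorentzian Literature.Geometry.Lorentzian.MetricCoord
open scoped Topology ContDiff Manifold

/-- **Locality of the three properties** (smooth, coordinate Killing, `∂_τ`-invariant): a field
which agrees on an open set `U` with a field having them on `U` has them at every point of `U`.
[folklore] -/
theorem farSweep_local (G : E4 → E4 →L[ℝ] E4 →L[ℝ] ℝ) (τ : E4) (k f : E4 → E4) (U : Set E4)
    (hU : IsOpen U) (hk : ContDiffOn ℝ ∞ k U)
    (hkil : ∀ y ∈ U, ∀ Y Z : E4,
      fderiv ℝ G y (k y) Y Z + G y (fderiv ℝ k y Y) Z + G y Y (fderiv ℝ k y Z) = 0)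
    (hinv : ∀ y ∈ U, fderiv ℝ k y τ = 0) (hf : EqOn f k U) {y : E4} (hy : y ∈ U) :
    ContDiffAt ℝ ∞ f y ∧
    (∀ Y Z : E4, fderiv ℝ G y (f y) Y Z + G y (fderiv ℝ f y Y) Z + G y Y (fderiv ℝ f y Z) = 0) ∧
    fderiv ℝ f y τ = 0 := by
  have hev : f =ᶠ[𝓝 y] k := hf.eventuallyEq_of_mem (hU.mem_nhds hy)
  refine ⟨((hk y hy).contDiffAt (hU.mem_nhds hy)).congr_of_eventuallyEq hev, fun Y Z ↦ ?_, ?_⟩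
  · rw [hev.fderiv_eq, hf hy]; exact hkil y hy Y Z
  · rw [hev.fderiv_eq]; exact hinv y hy

/-- Registration handle (the main theorem's signature exceeds the 4000-character stub cap):
membership in the dyadic arena from the far tube comparison. For `r x = c ∈ [cA, 2cA]`,
`‖y − x‖ < cA/4` and `16 M ≤ cA`: `cA/2 < r y < 4cA`. [folklore] -/
theorem farSweep_ball_subset_arena : ∀ (M a cA c : ℝ) (x y : E4), |a| ≤ M → 0 ≤ M → 16 * M ≤ cA →
    cA ≤ c → c ≤ 2 * cA → Kerr.radius a x = c → ‖y - x‖ < cA / 4 →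
    cA / 2 < Kerr.radius a y ∧ Kerr.radius a y < 4 * cA := by
  intro M a cA c x y haM hM hMc hc1 hc2 hx hy
  obtain ⟨h1, h2⟩ := stub_kerrRadiusFarTube M a x (y - x) haM
  rw [add_sub_cancel, hx] at h1 h2
  constructor <;> linarith

/-- **The dyadic far sweep (F5).** Let `G` be a metric datum on an open `W ⊇ {r > c₀/4}`,
`|a| ≤ M`, `16M ≤ c₀`, `0 < ρf' ≤ ρf ≤ 1/8`, and suppose the RELATIVE local extension step holds
on every cylinder `{r = c}`, `c ≥ c₀`: every `C^∞` coordinate Killing field on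
`ball x (ρf c) ∩ {r < c}` (`r x = c`) commuting with `τ` extends to one on `ball x (ρf' c)`,
commuting with `τ` and agreeing below the cylinder. Then every `C^∞` coordinate Killing field
`k₀` on the collar `{c₀/2 < r < c₀}` commuting with `τ` extends to one on the whole far region
`{r > c₀/2}`, commuting with `τ` and agreeing with `k₀` on the collar. Proof: induction over the
dyadic bands with `stub_kerrCoordKillingSweepSmoothT`, gluing on the overlaps, pointwise limit.
[folklore globalisation; cf. Alexakis–Ionescu–Klainerman, CMP 299 (2010), §6] -/
theorem farConditionalSweep :
    ∀ (G : E4 → E4 →L[ℝ] E4 →L[ℝ] ℝ) (W : Set E4) (a M c₀ ρf ρf' : ℝ) (τ : E4) (k₀ : E4 → E4),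
      IsMetricOn G W → 0 ≤ M → |a| ≤ M → 0 < c₀ → 16 * M ≤ c₀ → 0 < ρf → ρf ≤ 1 / 8 → 0 < ρf' →
      ρf' ≤ ρf → {y | c₀ / 4 < Kerr.radius a y} ⊆ W →
      (∀ c : ℝ, c₀ ≤ c → ∀ x : E4, Kerr.radius a x = c → ∀ k : E4 → E4,
        ContDiffOn ℝ ∞ k (ball x (ρf * c) ∩ {y | Kerr.radius a y < c}) →
        (∀ y ∈ ball x (ρf * c) ∩ {y | Kerr.radius a y < c}, ∀ Y Z : E4,
          fderiv ℝ G y (k y) Y Z + G y (fderiv ℝ k y Y) Z + G y Y (fderiv ℝ k y Z) = 0) →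
        (∀ y ∈ ball x (ρf * c) ∩ {y | Kerr.radius a y < c}, fderiv ℝ k y τ = 0) →
        ∃ k' : E4 → E4, ContDiffOn ℝ ∞ k' (ball x (ρf' * c)) ∧
          (∀ y ∈ ball x (ρf' * c), ∀ Y Z : E4,
            fderiv ℝ G y (k' y) Y Z + G y (fderiv ℝ k' y Y) Z + G y Y (fderiv ℝ k' y Z) = 0) ∧
          (∀ y ∈ ball x (ρf' * c), fderiv ℝ k' y τ = 0) ∧
          EqOn k' k (ball x (ρf' * c) ∩ {y | Kerr.radius a y < c})) →
      ContDiffOn ℝ ∞ k₀ {y | c₀ / 2 < Kerr.radius a y ∧ Kerr.radius a y < c₀} →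
      (∀ y ∈ {y : E4 | c₀ / 2 < Kerr.radius a y ∧ Kerr.radius a y < c₀}, ∀ Y Z : E4,
        fderiv ℝ G y (k₀ y) Y Z + G y (fderiv ℝ k₀ y Y) Z + G y Y (fderiv ℝ k₀ y Z) = 0) →
      (∀ y ∈ {y : E4 | c₀ / 2 < Kerr.radius a y ∧ Kerr.radius a y < c₀}, fderiv ℝ k₀ y τ = 0) →
      ∃ k : E4 → E4, ContDiffOn ℝ ∞ k {y | c₀ / 2 < Kerr.radius a y} ∧
        (∀ y ∈ {y : E4 | c₀ / 2 < Kerr.radius a y}, ∀ Y Z : E4,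
          fderiv ℝ G y (k y) Y Z + G y (fderiv ℝ k y Y) Z + G y Y (fderiv ℝ k y Z) = 0) ∧
        (∀ y ∈ {y : E4 | c₀ / 2 < Kerr.radius a y}, fderiv ℝ k y τ = 0) ∧
        EqOn k k₀ {y | c₀ / 2 < Kerr.radius a y ∧ Kerr.radius a y < c₀} := by
  intro G W a M c₀ ρf ρf' τ k₀ hG hM haM hc₀ hMc hρf hρf8 hρf' hρff hWsub hstep hk₀ hkil₀ hinv₀
  -- the dyadic radii and the nested regions `E n = {c₀/2 < r < c₀ 2ⁿ}`
  have hcpow : ∀ n : ℕ, c₀ ≤ c₀ * 2 ^ n := fun n ↦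
    le_mul_of_one_le_right hc₀.le (one_le_pow₀ (by norm_num))
  have hcpow' : ∀ n : ℕ, 0 < c₀ * 2 ^ n := fun n ↦ by positivity
  have hEmono : ∀ {n m : ℕ}, n ≤ m → ∀ y : E4,
      (c₀ / 2 < Kerr.radius a y ∧ Kerr.radius a y < c₀ * 2 ^ n) →
      (c₀ / 2 < Kerr.radius a y ∧ Kerr.radius a y < c₀ * 2 ^ m) := by
    intro n m hnm y hy
    exact ⟨hy.1, lt_of_lt_of_le hy.2 (mul_le_mul_of_nonneg_left (pow_le_pow_right₀ (by norm_num) hnm) hc₀.le)⟩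
  have hEopen : ∀ s : ℝ, IsOpen {y : E4 | c₀ / 2 < Kerr.radius a y ∧ Kerr.radius a y < s} := fun s ↦
    (isOpen_lt continuous_const (Kerr.continuous_radius a)).inter
      (isOpen_lt (Kerr.continuous_radius a) continuous_const)
  -- the induction step: from band `n` to band `n + 1`
  have step : ∀ (n : ℕ) (k : E4 → E4),
      (ContDiffOn ℝ ∞ k {y | c₀ / 2 < Kerr.radius a y ∧ Kerr.radius a y < c₀ * 2 ^ n} ∧
        (∀ y ∈ {y : E4 | c₀ / 2 < Kerr.radius a y ∧ Kerr.radius a y < c₀ * 2 ^ n}, ∀ Y Z : E4,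
          fderiv ℝ G y (k y) Y Z + G y (fderiv ℝ k y Y) Z + G y Y (fderiv ℝ k y Z) = 0) ∧
        (∀ y ∈ {y : E4 | c₀ / 2 < Kerr.radius a y ∧ Kerr.radius a y < c₀ * 2 ^ n}, fderiv ℝ k y τ = 0) ∧
        EqOn k k₀ {y | c₀ / 2 < Kerr.radius a y ∧ Kerr.radius a y < c₀}) →
      ∃ k' : E4 → E4,
        (ContDiffOn ℝ ∞ k' {y | c₀ / 2 < Kerr.radius a y ∧ Kerr.radius a y < c₀ * 2 ^ (n + 1)} ∧
          (∀ y ∈ {y : E4 | c₀ / 2 < Kerr.radius a y ∧ Kerr.radius a y < c₀ * 2 ^ (n + 1)}, ∀ Y Z : E4,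
            fderiv ℝ G y (k' y) Y Z + G y (fderiv ℝ k' y Y) Z + G y Y (fderiv ℝ k' y Z) = 0) ∧
          (∀ y ∈ {y : E4 | c₀ / 2 < Kerr.radius a y ∧ Kerr.radius a y < c₀ * 2 ^ (n + 1)},
            fderiv ℝ k' y τ = 0) ∧
          EqOn k' k₀ {y | c₀ / 2 < Kerr.radius a y ∧ Kerr.radius a y < c₀}) ∧
        EqOn k' k {y | c₀ / 2 < Kerr.radius a y ∧ Kerr.radius a y < c₀ * 2 ^ n} := by
    rintro n k ⟨hk, hkil, hkinv, hk0⟩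
    -- the band `[cA, cB]`, the arena `D` and the radii
    obtain ⟨cA, hcA⟩ : ∃ cA : ℝ, cA = c₀ * 2 ^ n := ⟨_, rfl⟩
    obtain ⟨cB, hcB⟩ : ∃ cB : ℝ, cB = c₀ * 2 ^ (n + 1) := ⟨_, rfl⟩
    have hcAc₀ : c₀ ≤ cA := by rw [hcA]; exact hcpow n
    have hcApos : 0 < cA := hc₀.trans_le hcAc₀
    have hcBA : cB = 2 * cA := by rw [hcA, hcB, pow_succ]; ring
    have hAB : cA ≤ cB := by rw [hcBA]; linarith
    have haA : |a| ≤ cA := by linarith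
    obtain ⟨D, hDdef⟩ : ∃ D : Set E4, D = {y | cA / 2 < Kerr.radius a y ∧ Kerr.radius a y < 4 * cA} :=
      ⟨_, rfl⟩
    have hD : IsOpen D := by
      rw [hDdef]
      exact (isOpen_lt continuous_const (Kerr.continuous_radius a)).inter
        (isOpen_lt (Kerr.continuous_radius a) continuous_const)
    have hDW : D ⊆ W := by
      intro y hy; rw [hDdef] at hy; exact hWsub (show c₀ / 4 < Kerr.radius a y by linarith [hy.1])
    have hρ : 0 < 2 * ρf * cA := by positivity
    have hρ' : 0 < ρf' * cA := by positivity
    -- balls of radius `2 ρf cA ≤ cA/4` around band cylinders stay in the arena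
    have hball : ∀ c ∈ Icc cA cB, ∀ x : E4, Kerr.radius a x = c → ball x (2 * ρf * cA) ⊆ D := by
      intro c hc x hx y hy
      rw [mem_ball, dist_eq_norm] at hy
      have hy' : ‖y - x‖ < cA / 4 := by
        have : 2 * ρf * cA ≤ cA / 4 := by nlinarith
        linarith
      rw [hDdef]
      exact farSweep_ball_subset_arena M a cA c x y haM hM (by linarith) hc.1 (by rw [← hcBA]; exact hc.2)
        hx hy'
    -- the uniform local step on the band, from the relative step `hstep`
    have hloc : ∀ c ∈ Icc cA cB, ∀ x : E4, Kerr.radius a x = c → ∀ k₁ : E4 → E4,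
        ContDiffOn ℝ ∞ k₁ (ball x (2 * ρf * cA) ∩ {y | Kerr.radius a y < c}) →
        (∀ y ∈ ball x (2 * ρf * cA) ∩ {y | Kerr.radius a y < c}, ∀ Y Z : E4,
          fderiv ℝ G y (k₁ y) Y Z + G y (fderiv ℝ k₁ y Y) Z + G y Y (fderiv ℝ k₁ y Z) = 0) →
        (∀ y ∈ ball x (2 * ρf * cA) ∩ {y | Kerr.radius a y < c}, fderiv ℝ k₁ y τ = 0) →
        ∃ k' : E4 → E4, ContDiffOn ℝ ∞ k' (ball x (ρf' * cA)) ∧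
          (∀ y ∈ ball x (ρf' * cA), ∀ Y Z : E4,
            fderiv ℝ G y (k' y) Y Z + G y (fderiv ℝ k' y Y) Z + G y Y (fderiv ℝ k' y Z) = 0) ∧
          (∀ y ∈ ball x (ρf' * cA), fderiv ℝ k' y τ = 0) ∧
          EqOn k' k₁ (ball x (ρf' * cA) ∩ {y | Kerr.radius a y < c}) := by
      intro c hc x hx k₁ h1 h2 h3
      have hcc₀ : c₀ ≤ c := hcAc₀.trans hc.1
      have hsub : ball x (ρf * c) ⊆ ball x (2 * ρf * cA) := by
        apply ball_subset_ball
        have : c ≤ 2 * cA := by rw [← hcBA]; exact hc.2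
        nlinarith
      have hsub' : ball x (ρf' * cA) ⊆ ball x (ρf' * c) := by
        apply ball_subset_ball
        nlinarith [hc.1]
      obtain ⟨k', hk'1, hk'2, hk'3, hk'4⟩ := hstep c hcc₀ x hx k₁
        (h1.mono (inter_subset_inter_left _ hsub))
        (fun y hy ↦ h2 y ⟨hsub hy.1, hy.2⟩) (fun y hy ↦ h3 y ⟨hsub hy.1, hy.2⟩)
      exact ⟨k', hk'1.mono hsub', fun y hy ↦ hk'2 y (hsub' hy), fun y hy ↦ hk'3 y (hsub' hy),
        hk'4.mono (inter_subset_inter_left _ hsub')⟩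
    -- the initial datum of the sweep: `k` on `D ∩ {r < cA} ⊆ E n`
    have hinit : D ∩ {y | Kerr.radius a y < cA} ⊆
        {y | c₀ / 2 < Kerr.radius a y ∧ Kerr.radius a y < c₀ * 2 ^ n} := by
      rintro y ⟨hyD, hyc⟩
      rw [hDdef] at hyD
      exact ⟨by linarith [hyD.1], by rw [← hcA]; exact hyc⟩
    obtain ⟨k', hk'cd, hk'kil, hk'inv, hk'eq⟩ := stub_kerrCoordKillingSweepSmoothT G W D a cA cB
      (2 * ρf * cA) (ρf' * cA) τ k hG hD hDW hAB hcApos haA hρ' hρ hball hloc (hk.mono hinit)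
      (fun y hy ↦ hkil y (hinit hy)) (fun y hy ↦ hkinv y (hinit hy))
    -- glue `k` (on `E n`) and `k'` (on `D ∩ {r < cB}`)
    classical
    obtain ⟨f, hf⟩ : ∃ f : E4 → E4, f = fun y ↦ if Kerr.radius a y < cA then k y else k' y := ⟨_, rfl⟩
    have hU₂ : IsOpen (D ∩ {y | Kerr.radius a y < cB}) :=
      hD.inter (isOpen_lt (Kerr.continuous_radius a) continuous_const)
    have hf₁ : EqOn f k {y | c₀ / 2 < Kerr.radius a y ∧ Kerr.radius a y < c₀ * 2 ^ n} := by
      intro y hy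
      rw [hf]
      simp only [show Kerr.radius a y < cA by rw [hcA]; exact hy.2, if_true]
    have hf₂ : EqOn f k' (D ∩ {y | Kerr.radius a y < cB}) := by
      intro y hy
      rw [hf]
      by_cases h : Kerr.radius a y < cA
      · simp only [h, if_true]
        exact (hk'eq ⟨hy.1, h⟩).symm
      · simp only [h, if_false]
    have hcover : ∀ y : E4, (c₀ / 2 < Kerr.radius a y ∧ Kerr.radius a y < c₀ * 2 ^ (n + 1)) →
        y ∈ {y | c₀ / 2 < Kerr.radius a y ∧ Kerr.radius a y < c₀ * 2 ^ n} ∨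
          y ∈ D ∩ {y | Kerr.radius a y < cB} := by
      intro y hy
      by_cases h : Kerr.radius a y < cA
      · exact Or.inl ⟨hy.1, by rw [← hcA]; exact h⟩
      · refine Or.inr ⟨?_, by rw [hcB]; exact hy.2⟩
        rw [hDdef]
        refine ⟨by rw [not_lt] at h; linarith, ?_⟩
        have : Kerr.radius a y < cB := by rw [hcB]; exact hy.2
        rw [hcBA] at this; linarith
    have hloc₁ := fun y (hy : y ∈ {y : E4 | c₀ / 2 < Kerr.radius a y ∧ Kerr.radius a y < c₀ * 2 ^ n}) ↦
      farSweep_local G τ k f _ (hEopen _) hk hkil hkinv hf₁ hy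
    have hloc₂ := fun y (hy : y ∈ D ∩ {y : E4 | Kerr.radius a y < cB}) ↦
      farSweep_local G τ k' f _ hU₂ hk'cd hk'kil hk'inv hf₂ hy
    refine ⟨f, ⟨fun y hy ↦ ?_, fun y hy Y Z ↦ ?_, fun y hy ↦ ?_, fun y hy ↦ ?_⟩, hf₁⟩
    · rcases hcover y hy with h | h
      · exact (hloc₁ y h).1.contDiffWithinAt
      · exact (hloc₂ y h).1.contDiffWithinAt
    · rcases hcover y hy with h | h
      · exact (hloc₁ y h).2.1 Y Z
      · exact (hloc₂ y h).2.1 Y Z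
    · rcases hcover y hy with h | h
      · exact (hloc₁ y h).2.2
      · exact (hloc₂ y h).2.2
    · have hy' : y ∈ {y : E4 | c₀ / 2 < Kerr.radius a y ∧ Kerr.radius a y < c₀ * 2 ^ n} :=
        ⟨hy.1, lt_of_lt_of_le hy.2 (hcpow n)⟩
      rw [hf₁ hy']; exact hk0 hy
  -- the sequence of fields
  choose! nxt hnxt using step
  obtain ⟨F, hF⟩ : ∃ F : ℕ → (E4 → E4), F = fun n ↦ Nat.rec k₀ (fun m km ↦ nxt m km) n := ⟨_, rfl⟩
  have hF0 : F 0 = k₀ := by rw [hF]; rfl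
  have hFs : ∀ n, F (n + 1) = nxt n (F n) := fun n ↦ by rw [hF]
  have hk₀' : EqOn k₀ k₀ {y | c₀ / 2 < Kerr.radius a y ∧ Kerr.radius a y < c₀} := fun _ _ ↦ rfl
  have hQ : ∀ n : ℕ,
      ContDiffOn ℝ ∞ (F n) {y | c₀ / 2 < Kerr.radius a y ∧ Kerr.radius a y < c₀ * 2 ^ n} ∧
      (∀ y ∈ {y : E4 | c₀ / 2 < Kerr.radius a y ∧ Kerr.radius a y < c₀ * 2 ^ n}, ∀ Y Z : E4,
        fderiv ℝ G y (F n y) Y Z + G y (fderiv ℝ (F n) y Y) Z + G y Y (fderiv ℝ (F n) y Z) = 0) ∧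
      (∀ y ∈ {y : E4 | c₀ / 2 < Kerr.radius a y ∧ Kerr.radius a y < c₀ * 2 ^ n}, fderiv ℝ (F n) y τ = 0) ∧
      EqOn (F n) k₀ {y | c₀ / 2 < Kerr.radius a y ∧ Kerr.radius a y < c₀} := by
    intro n
    induction n with
    | zero =>
      rw [hF0]
      simp only [pow_zero, mul_one]
      exact ⟨hk₀, hkil₀, hinv₀, hk₀'⟩
    | succ n ih =>
      rw [hFs]
      exact (hnxt n (F n) ih).1
  have hcompat : ∀ n m : ℕ, n ≤ m →
      EqOn (F m) (F n) {y | c₀ / 2 < Kerr.radius a y ∧ Kerr.radius a y < c₀ * 2 ^ n} := by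
    intro n m hnm
    induction m, hnm using Nat.le_induction with
    | base => exact fun _ _ ↦ rfl
    | succ m hnm ih =>
      intro y hy
      rw [hFs, (hnxt m (F m) (hQ m)).2 (hEmono hnm y hy)]
      exact ih hy
  -- the limit field
  have hex : ∀ y : E4, ∃ n : ℕ, Kerr.radius a y < c₀ * 2 ^ n := by
    intro y
    obtain ⟨n, hn⟩ := pow_unbounded_of_one_lt (Kerr.radius a y / c₀) (one_lt_two : (1 : ℝ) < 2)
    exact ⟨n, by rwa [div_lt_iff₀ hc₀, mul_comm] at hn⟩
  classical
  obtain ⟨kf, hkf⟩ : ∃ kf : E4 → E4, kf = fun y ↦ F (Nat.find (hex y)) y := ⟨_, rfl⟩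
  have hkfF : ∀ n : ℕ, EqOn kf (F n) {y | c₀ / 2 < Kerr.radius a y ∧ Kerr.radius a y < c₀ * 2 ^ n} := by
    intro n y hy
    rw [hkf]
    have hN : Kerr.radius a y < c₀ * 2 ^ Nat.find (hex y) := Nat.find_spec (hex y)
    rcases le_total (Nat.find (hex y)) n with h | h
    · exact (hcompat _ _ h ⟨hy.1, hN⟩).symm
    · exact hcompat _ _ h hy
  refine ⟨kf, fun y hy ↦ ?_, fun y hy Y Z ↦ ?_, fun y hy ↦ ?_, fun y hy ↦ ?_⟩
  · obtain ⟨n, hn⟩ := hex y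
    exact (farSweep_local G τ (F n) kf _ (hEopen _) (hQ n).1 (hQ n).2.1 (hQ n).2.2.1 (hkfF n)
      ⟨hy, hn⟩).1.contDiffWithinAt
  · obtain ⟨n, hn⟩ := hex y
    exact (farSweep_local G τ (F n) kf _ (hEopen _) (hQ n).1 (hQ n).2.1 (hQ n).2.2.1 (hkfF n)
      ⟨hy, hn⟩).2.1 Y Z
  · obtain ⟨n, hn⟩ := hex y
    exact (farSweep_local G τ (F n) kf _ (hEopen _) (hQ n).1 (hQ n).2.1 (hQ n).2.2.1 (hkfF n)
      ⟨hy, hn⟩).2.2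
  · have hy0 : y ∈ {y : E4 | c₀ / 2 < Kerr.radius a y ∧ Kerr.radius a y < c₀ * 2 ^ 0} := by
      simpa using hy
    rw [hkfF 0 hy0]
    exact (hQ 0).2.2.2 hy

end Summit.FinalStateConjecture.FinalStateConjecture.Theorems

end
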